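/-
Copyright (c) 2026. Released under the Apache 2.0 license.
-/
import Literature.NumberTheory.EllipticCurves.SemistabilityDefectAtThreeTameWitnessProofs
import Literature.NumberTheory.EllipticCurves.NeronLocalHeightTateLemma
import Literature.NumberTheory.EllipticCurves.ThreeTorsionRadicalProofs
import HarnessLib

/-!
# The quadratic character of a rational `3`-kernel on the Kodaira III / III* rows at `3`:
# `v₃(ψ₂²(x₀))` is EVEN on type III and ODD on type III* — PROVED
# (the local law L14a of route `TameQuarticManinParity`; Barrios–Roy 2022 Thm. 3.4/3.5 in the
# rational-`3`-torsion case)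

`Proofs` file (theorems only: no definition, no named fact, no instance, no `sorry`), topic
`Literature/NumberTheory/EllipticCurves`; sequel of `SemistabilityDefectAtThreeTameWitnessProofs.lean`
(which supplies the `ℚ`-RATIONAL Tate normal forms of types III and III* at a place `v ∤ 2`).
Declarations in `namespace WeierstrassCurve` are deliberate dot-notation extensions of the Mathlib
namespace (as in the prequel), and say so here.

## The statement

Let `W/ℚ` be an elliptic curve whose Kodaira symbol at the place `v = (3)` of `ℤ` is III or III*
(the tame quartic rows `(t′)` at `3`: additive, potentially good, semistability defect `e = 4`,
`ord₃ Δ_min ∈ {3, 9}`), and let `x₀ ∈ ℚ` be a root of the `3`-division polynomial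
`Ψ₃ = 3x⁴ + b₂x³ + 3b₄x² + 3b₆x + b₈` (Silverman *AEC* III Ex. 3.7), i.e. the abscissa of a point
`P = (x₀, y₀)` of exact order `3` whose subgroup `{O, ±P}` is `ℚ`-rational. The field of definition of
`P` is `ℚ(√D)`, `D = ψ₂²(x₀) = (2y₀ + a₁x₀ + a₃)² = 4x₀³ + b₂x₀² + 2b₄x₀ + b₆` (Mathlib `Ψ₂Sq`), so the
Galois character of the kernel is `χ_D`, UNRAMIFIED at `3` iff `v₃(D)` is even. We prove:

* `WeierstrassCurve.padicValRat_Ψ₂Sq_eq_of_kodairaSymbolAt_eq_III`: type III ⟹ `D ≠ 0` and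
  `v₃(D) = 6·v₃(u)` for some `u ∈ ℚˣ` (so `v₃(D)` is EVEN: `even_padicValRat_Ψ₂Sq_of_kodairaSymbolAt_eq_III`);
* `WeierstrassCurve.padicValRat_Ψ₂Sq_eq_of_kodairaSymbolAt_eq_IIIstar`: type III* ⟹ `D ≠ 0` and
  `v₃(D) = 3 + 6·v₃(u)` (so `v₃(D)` is ODD: `odd_padicValRat_Ψ₂Sq_of_kodairaSymbolAt_eq_IIIstar`);
* the dictionary forms **`even_padicValRat_Ψ₂Sq_iff_kodairaSymbolAt_eq_III`**,
  **`even_padicValRat_iff_ordMinimalDiscriminant_eq_three`** (on the III / III* rows: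
  `v₃(4x₀³ + b₂x₀² + 2b₄x₀ + b₆)` even ⟺ type III ⟺ `ord₃ Δ_min = 3`), which is verbatim the local law
  `TprimeKernelUnramifiedIffKodairaThree` (item L14a, stmt-BirchSwinnertonDyer-27956) of the route
  `Summits/BirchSwinnertonDyer/…/Theses/TameQuarticManinParity.lean` once its census hypotheses
  `Addv W 3 ∧ SubTprime W 3` are read as "Kodaira III or III* at `3`" (Summits-side dictionary
  `subTprime_three_iff_kodairaSymbolAt_III_or_IIIstar`, `ordMinimalDiscriminant_placeOf_eq`) — that
  six-line wrapper is the prover's, not this file's.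

No optimality, minimality or integrality hypothesis on the model `W` is needed: the statement is
covariant (§1).

## The proof (valuation bookkeeping on Tate's normal forms; no Tate-algorithm case analysis)

§1 (`eval` of `Ψ₂Sq`, `Ψ₃` is reused from `NeronLocalHeightTateLemma` / `ThreeTorsionRadicalProofs`.) Under a change of variables `(u; r, s, t)` the division polynomials are covariant:
`Ψ₃' (u⁻²(x − r)) = u⁻⁸ Ψ₃(x)`, `ψ₂²'(u⁻²(x − r)) = u⁻⁶ ψ₂²(x)` (Silverman *AEC* III Ex. 3.7 with
Table 3.1) — so a rational `Ψ₃`-root is transported to any other `ℚ`-model and `v₃(D)` changes by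
`6 v₃(u)`, an even integer.
§2 (bookkeeping at the place over `3`: `|3| = exp(−1)`, `|2| = |4| = 1`, `|n| ≤ 1`.)
§3 On a TYPE-III NORMAL FORM (`v₃(a₁), v₃(a₂), v₃(a₃), v₃(a₄) ≥ 1`, `v₃(a₆) ≥ 2`, `v₃(Δ) = 3`;
Silverman *ATAEC* IV.9.4 Step 4): `v₃(b₂) ≥ 1`, `v₃(b₄) ≥ 1`, `v₃(b₆) ≥ 2`, `v₃(b₈) ≥ 2`, and
`v₃(Δ) = 3` forces successively `v₃(b₄) = 1` (all four terms of `Δ = −b₂²b₈ − 8b₄³ − 27b₆² + 9b₂b₄b₆`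
have valuation `≥ 4` otherwise), `v₃(a₄) = 1`, `v₃(b₈) = 2` (`b₈ ≡ −a₄²` mod `3³`). A root `x₀` of
`3x⁴ + b₂x³ + 3b₄x² + 3b₆x + b₈` then has `v₃(x₀) = 0`: if `v₃(x₀) ≥ 1` the term `b₈` is the unique
term of least valuation, if `v₃(x₀) ≤ −1` the term `3x₀⁴` is; hence `v₃(D) = v₃(4x₀³) = 0`.
§4 On a TYPE-III* NORMAL FORM (`v₃(a₁) ≥ 1`, `v₃(a₂) ≥ 2`, `v₃(a₃), v₃(a₄) ≥ 3`, `v₃(a₆) ≥ 5`,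
`v₃(Δ) = 9`; *ATAEC* IV.9.4 Step 9): `v₃(b₂) ≥ 2`, `v₃(b₄) = 3`, `v₃(b₆) ≥ 5`, `v₃(b₈) = 6`, and the same
argument gives `v₃(x₀) = 1`, `v₃(D) = v₃(4x₀³) = 3`.
§5 Transport back to `W` by §1 with the prequel's rational normal forms
`exists_variableChange_tateNormalForm_III / _IIIstar`.

In print, the rational-`3`-TORSION case (`D` a square) is read off the local-data tables of
[BarriosRoy2022LocalData] (Thm. 3.4 for `E_{C₃⁰}(a) : y² + a y = x³` — at `3` only II, III, IV, IV*; Thm. 3.5 for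
`E_{C₃}(a,b) : y² + a xy + b y = x³` — at `3` only II, III, IV, I₀*, Iₙ*, IV*, …; type III* never occurs
with a rational point of order `3`), proved there by Tate's algorithm on the parametrised families and
Papadopoulos's tables; the statement here is the kernel (not point) version, both parities, with a
direct valuation proof.

## What is NOT here

Nothing about optimal curves, Manin constants or modular parametrisations (the route's items V19 /
E19 / K19 and its Manin cruxes are untouched); nothing at `p ≠ 3` (at `p ≥ 5` the same bookkeeping
gives `v_p(D) = 0` on III and `v_p(x₀) = 1`, `v_p(D) = 3` on III*, not recorded); no statement about
the `y`-coordinate or the field `ℚ(P)` itself (only the abscissa and `D`).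

## References

* [BarriosRoy2022LocalData] A. Barrios, M. Roy, *Local data of rational elliptic curves with nontrivial
  torsion*, Pacific J. Math. 318 (2022) 1–42, Thm. 3.4 and Thm. 3.5 (held text arXiv:2104.10337,
  chunks p0014 L57–L175, p0015 L1–L60).
* [SilvermanAEC2009] J. H. Silverman, *The Arithmetic of Elliptic Curves*, GTM 106 (2nd ed.), III §1
  Table 3.1 (change of variables), III Ex. 3.7 (division polynomials `ψ₂² = 4x³ + b₂x² + 2b₄x + b₆`,
  `ψ₃ = 3x⁴ + b₂x³ + 3b₄x² + 3b₆x + b₈`), VII.1.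
* [SilvermanATAEC1994] J. H. Silverman, *Advanced Topics*, GTM 151, IV.9.4 Steps 4 and 9, Table 4.1.
-/

noncomputable section

open scoped Classical

open IsDedekindDomain IsDedekindDomain.HeightOneSpectrum WithZero Polynomial

namespace WeierstrassCurve

/-! ## §1. Covariance of `Ψ₂Sq` and `Ψ₃` under a change of variables -/

section Covariance

variable {R : Type*} [CommRing R] (W : WeierstrassCurve R) (C : VariableChange R)

-- `W.Ψ₂Sq.eval x = 4x³ + b₂x² + 2b₄x + b₆` and `W.Ψ₃.eval x = 3x⁴ + b₂x³ + 3b₄x² + 3b₆x + b₈` are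
-- the tree's `WeierstrassCurve.Affine.Point.eval_Ψ₂Sq` (`NeronLocalHeightTateLemma`) and
-- `WeierstrassCurve.eval_Ψ₃_eq` (`ThreeTorsionRadicalProofs`), reused here.

/-- **Covariance of `Ψ₃`** under `(u; r, s, t)`, `x = u²x' + r`: `Ψ₃'(u⁻²(x − r)) = u⁻⁸ Ψ₃(x)`
(Silverman *AEC* III Table 3.1 for `bᵢ'`; `ψₙ' = u^{1−n²} ψₙ`).
[cite: SilvermanAEC2009, III §1 Table 3.1 and Ex. 3.7] -/
theorem eval_Ψ₃_variableChange (x : R) :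
    (C • W).Ψ₃.eval (((C.u⁻¹ : Rˣ) : R) ^ 2 * (x - C.r)) = ((C.u⁻¹ : Rˣ) : R) ^ 8 * W.Ψ₃.eval x := by
  simp only [eval_Ψ₃_eq, variableChange_b₂, variableChange_b₄, variableChange_b₆, variableChange_b₈]
  ring

/-- **Covariance of `ψ₂²`** under `(u; r, s, t)`: `ψ₂²'(u⁻²(x − r)) = u⁻⁶ ψ₂²(x)`
(`2y' + a₁'x' + a₃' = u⁻³ (2y + a₁x + a₃)`). [cite: SilvermanAEC2009, III §1 Table 3.1 and Ex. 3.7] -/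
theorem eval_Ψ₂Sq_variableChange (x : R) :
    (C • W).Ψ₂Sq.eval (((C.u⁻¹ : Rˣ) : R) ^ 2 * (x - C.r)) = ((C.u⁻¹ : Rˣ) : R) ^ 6 * W.Ψ₂Sq.eval x := by
  simp only [Affine.Point.eval_Ψ₂Sq, variableChange_b₂, variableChange_b₄, variableChange_b₆]
  ring

end Covariance

/-! ## §2. Valuation bookkeeping (any valuation into `ℤᵐ⁰`; then the place of `ℤ` over `3`) -/

section ValGeneric

variable {L : Type*} [Field L]

/-- Every nonzero element has valuation `exp n` for some `n ∈ ℤ`. [folklore] -/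
private theorem val_exists_exp (val : Valuation L ℤᵐ⁰) {x : L} (hx : x ≠ 0) :
    ∃ n : ℤ, val x = exp n :=
  ⟨log (val x), (exp_log ((Valuation.ne_zero_iff val).mpr hx)).symm⟩

/-- Discreteness: `|x| ≤ exp n` and `¬ |x| ≤ exp (n − 1)` force `|x| = exp n`. [folklore] -/
private theorem val_eq_exp_of_le_of_not_le (val : Valuation L ℤᵐ⁰) {x : L} {n : ℤ}
    (h1 : val x ≤ exp n) (h2 : ¬ val x ≤ exp (n - 1)) : val x = exp n := by
  have hx : x ≠ 0 := by
    rintro rfl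
    exact h2 (by rw [map_zero]; exact zero_le)
  obtain ⟨k, hk⟩ := val_exists_exp val hx
  rw [hk, exp_le_exp] at h1 h2
  rw [hk, exp_inj]
  omega

variable {val : Valuation L ℤᵐ⁰}

/-- `|a| ≤ exp m`, `m ≤ n` ⟹ `|a| ≤ exp n`. [folklore] -/
private theorem vle_mono {a : L} {m n : ℤ} (ha : val a ≤ exp m) (h : m ≤ n) : val a ≤ exp n :=
  ha.trans (exp_le_exp.2 h)

/-- `|a| ≤ exp m`, `m < n` ⟹ `|a| < exp n`. [folklore] -/
private theorem vlt_of_le {a : L} {m n : ℤ} (ha : val a ≤ exp m) (h : m < n) : val a < exp n :=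
  lt_of_le_of_lt ha (exp_lt_exp.2 h)

/-- Products, upper bound with slack. [folklore] -/
private theorem vmul_le {a b : L} {m n t : ℤ} (ha : val a ≤ exp m) (hb : val b ≤ exp n)
    (h : m + n ≤ t) : val (a * b) ≤ exp t := by
  rw [map_mul]
  exact (mul_le_mul' ha hb).trans (by rw [← exp_add, exp_le_exp]; exact h)

/-- Products, exact. [folklore] -/
private theorem vmul_eq {a b : L} {m n t : ℤ} (ha : val a = exp m) (hb : val b = exp n)
    (h : m + n = t) : val (a * b) = exp t := by
  rw [map_mul, ha, hb, ← exp_add, h]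

/-- Powers, upper bound with slack. [folklore] -/
private theorem vpow_le {a : L} {m t : ℤ} (ha : val a ≤ exp m) (k : ℕ) (h : (k : ℤ) * m ≤ t) :
    val (a ^ k) ≤ exp t := by
  rw [map_pow]
  refine (pow_le_pow_left₀ zero_le ha k).trans ?_
  rw [← exp_nsmul, nsmul_eq_mul, exp_le_exp]
  exact h

/-- Powers, exact. [folklore] -/
private theorem vpow_eq {a : L} {m t : ℤ} (ha : val a = exp m) (k : ℕ) (h : (k : ℤ) * m = t) :
    val (a ^ k) = exp t := by
  rw [map_pow, ha, ← exp_nsmul, nsmul_eq_mul, h]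

/-- Negation. [folklore] -/
private theorem vneg_le {a : L} {m : ℤ} (ha : val a ≤ exp m) : val (-a) ≤ exp m := by
  rwa [Valuation.map_neg]

end ValGeneric

section ValThree

open Rat.HeightOneSpectrum

variable (v : HeightOneSpectrum ℤ)

/-- `|3|_v = exp (−1)` at the place over `3`. [folklore] -/
private theorem val_three (hv : ((primesEquiv (R := ℤ) v : Nat.Primes) : ℕ) = 3) :
    v.valuation ℚ (3 : ℚ) = exp (-1 : ℤ) := by
  have hgen : natGenerator v = 3 := hv
  have h := valuation_natGenerator_int v
  rw [hgen] at h
  exact_mod_cast h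

/-- `|n|_v = exp 0` at the place over `3` for `3 ∤ n`. [folklore] -/
private theorem val_natCast_eq_one_of_not_dvd (hv : ((primesEquiv (R := ℤ) v : Nat.Primes) : ℕ) = 3)
    {n : ℕ} (hn0 : n ≠ 0) (hn : ¬ 3 ∣ n) : v.valuation ℚ (n : ℚ) = exp (0 : ℤ) := by
  have hgen : natGenerator v = 3 := hv
  rw [valuation_eq_exp_neg_padicValRat v (by exact_mod_cast hn0 : (n : ℚ) ≠ 0), hgen, exp_inj,
    padicValRat.of_nat, padicValNat.eq_zero_of_not_dvd hn]
  simp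

/-- `|2|_v = 1` at the place over `3`. [folklore] -/
private theorem val_two (hv : ((primesEquiv (R := ℤ) v : Nat.Primes) : ℕ) = 3) :
    v.valuation ℚ (2 : ℚ) = 1 := by
  rw [← exp_zero, show (2 : ℚ) = ((2 : ℕ) : ℚ) by norm_num]
  exact val_natCast_eq_one_of_not_dvd v hv (by decide) (by decide)

/-- `|4|_v = exp 0` at the place over `3`. [folklore] -/
private theorem val_four (hv : ((primesEquiv (R := ℤ) v : Nat.Primes) : ℕ) = 3) :
    v.valuation ℚ (4 : ℚ) = exp (0 : ℤ) := by
  rw [show (4 : ℚ) = ((4 : ℕ) : ℚ) by norm_num]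
  exact val_natCast_eq_one_of_not_dvd v hv (by decide) (by decide)

end ValThree

/-! ## §3. The type-III normal form: `v₃(x₀) = 0` and `v₃(ψ₂²(x₀)) = 0` (any valued field with `|3| = exp(−1)`, `|2| = 1`) -/

section NormalFormIII

variable {L : Type*} [Field L] (X : WeierstrassCurve L) (val : Valuation L ℤᵐ⁰)

/-- **On a type-III Tate normal form** over any field `L` with a valuation `|·| : L → ℤᵐ⁰`,
`|3| = exp(−1)`, `|2| = 1` (e.g. `ℚ` or `ℚ₃` with `v₃`, or any unramified extension), profile
`v(a₁), v(a₂), v(a₃), v(a₄) ≥ 1`, `v(a₆) ≥ 2`, `v(Δ) = 3` (Silverman *ATAEC* IV.9.4 Step 4): **every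
root `x₀ ∈ L` of `Ψ₃` is a unit and `ψ₂²(x₀) = 4x₀³ + b₂x₀² + 2b₄x₀ + b₆` is a unit.** Bookkeeping: `v₃(Δ) = 3` forces
`v₃(b₄) = 1`, `v₃(a₄) = 1`, `v₃(b₈) = 2`; then in `3x₀⁴ + b₂x₀³ + 3b₄x₀² + 3b₆x₀ + b₈ = 0` the term `b₈`
(if `v₃(x₀) ≥ 1`) resp. `3x₀⁴` (if `v₃(x₀) ≤ −1`) would be the unique term of least valuation.
[cite: SilvermanATAEC1994, IV.9.4 Step 4 and Table 4.1 (type III)] [cite: SilvermanAEC2009, III Ex. 3.7] -/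
theorem valuation_root_Ψ₃_of_tateNormalForm_III (h2 : val 2 = 1) (h3 : val 3 = exp (-1 : ℤ))
    (h₁ : val X.a₁ ≤ exp (-1 : ℤ)) (h₂ : val X.a₂ ≤ exp (-1 : ℤ))
    (h₃ : val X.a₃ ≤ exp (-1 : ℤ)) (h₄ : val X.a₄ ≤ exp (-1 : ℤ))
    (h₆ : val X.a₆ ≤ exp (-2 : ℤ)) (hΔ : val X.Δ = exp (-3 : ℤ))
    {x : L} (hx : X.Ψ₃.eval x = 0) :
    val x = exp (0 : ℤ) ∧ val (X.Ψ₂Sq.eval x) = exp (0 : ℤ) := by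
  have v3 := h3
  have v4 : val (4 : L) = exp (0 : ℤ) := by
    rw [show (4 : L) = 2 * 2 by norm_num, map_mul, h2, mul_one, exp_zero]
  have n2 : val (2 : L) ≤ exp (0 : ℤ) := by rw [h2, exp_zero]
  have n4 : val (4 : L) ≤ exp (0 : ℤ) := v4.le
  have n8 : val (8 : L) ≤ exp (0 : ℤ) := by
    rw [show (8 : L) = 2 * 2 * 2 by norm_num, map_mul, map_mul, h2, mul_one, mul_one, exp_zero]
  have n9 : val (9 : L) ≤ exp (0 : ℤ) := by
    rw [show (9 : L) = 3 * 3 by norm_num, map_mul, h3, ← exp_add, exp_le_exp]; norm_num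
  have n27 : val (27 : L) ≤ exp (0 : ℤ) := by
    rw [show (27 : L) = 3 * 3 * 3 by norm_num, map_mul, map_mul, h3, ← exp_add, ← exp_add, exp_le_exp]
    norm_num
  -- the `b`-invariants
  have hb₂ : val X.b₂ ≤ exp (-1 : ℤ) := by
    rw [WeierstrassCurve.b₂]
    exact Valuation.map_add_le _ (vpow_le h₁ 2 (by norm_num)) (vmul_le n4 h₂ (by norm_num))
  have hb₄ : val X.b₄ ≤ exp (-1 : ℤ) := by
    rw [WeierstrassCurve.b₄]
    exact Valuation.map_add_le _ (vmul_le n2 h₄ (by norm_num)) (vmul_le h₁ h₃ (by norm_num))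
  have hb₆ : val X.b₆ ≤ exp (-2 : ℤ) := by
    rw [WeierstrassCurve.b₆]
    exact Valuation.map_add_le _ (vpow_le h₃ 2 (by norm_num)) (vmul_le n4 h₆ (by norm_num))
  have hR : val (X.a₁ ^ 2 * X.a₆ + 4 * X.a₂ * X.a₆ - X.a₁ * X.a₃ * X.a₄ + X.a₂ * X.a₃ ^ 2)
      ≤ exp (-3 : ℤ) :=
    Valuation.map_add_le _
      (Valuation.map_sub_le _
        (Valuation.map_add_le _ (vmul_le (vpow_le h₁ 2 le_rfl) h₆ (by norm_num))
          (vmul_le (vmul_le n4 h₂ le_rfl) h₆ (by norm_num)))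
        (vmul_le (vmul_le h₁ h₃ le_rfl) h₄ (by norm_num)))
      (vmul_le h₂ (vpow_le h₃ 2 le_rfl) (by norm_num))
  have hb₈ : val X.b₈ ≤ exp (-2 : ℤ) := by
    rw [WeierstrassCurve.b₈]
    exact Valuation.map_sub_le _ (vle_mono hR (by norm_num)) (vpow_le h₄ 2 (by norm_num))
  -- `v₃(b₄) = 1` exactly, from `v₃(Δ) = 3`
  have hb₄' : val X.b₄ = exp (-1 : ℤ) := by
    refine val_eq_exp_of_le_of_not_le val hb₄ fun hb => ?_
    have hΔle : val X.Δ ≤ exp (-4 : ℤ) := by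
      rw [WeierstrassCurve.Δ]
      refine Valuation.map_add_le _ (Valuation.map_sub_le _ (Valuation.map_sub_le _ ?_ ?_) ?_) ?_
      · exact vmul_le (vneg_le (vpow_le hb₂ 2 le_rfl)) hb₈ (by norm_num)
      · exact vmul_le n8 (vpow_le hb 3 le_rfl) (by norm_num)
      · exact vmul_le n27 (vpow_le hb₆ 2 le_rfl) (by norm_num)
      · exact vmul_le (vmul_le (vmul_le n9 hb₂ le_rfl) hb le_rfl) hb₆ (by norm_num)
    rw [hΔ, exp_le_exp] at hΔle
    omega
  -- `v₃(a₄) = 1` exactly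
  have ha₄' : val X.a₄ = exp (-1 : ℤ) := by
    refine val_eq_exp_of_le_of_not_le val h₄ fun ha => ?_
    have : val X.b₄ ≤ exp (-2 : ℤ) := by
      rw [WeierstrassCurve.b₄]
      exact Valuation.map_add_le _ (vmul_le n2 ha (by norm_num)) (vmul_le h₁ h₃ (by norm_num))
    rw [hb₄', exp_le_exp] at this
    omega
  -- `v₃(b₈) = 2` exactly
  have ha4sq : val (X.a₄ ^ 2) = exp (-2 : ℤ) := vpow_eq ha₄' 2 (by norm_num)
  have hb₈' : val X.b₈ = exp (-2 : ℤ) := by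
    have hlt : val (X.a₁ ^ 2 * X.a₆ + 4 * X.a₂ * X.a₆ - X.a₁ * X.a₃ * X.a₄ + X.a₂ * X.a₃ ^ 2)
        < val (X.a₄ ^ 2) := by
      rw [ha4sq]; exact vlt_of_le hR (by norm_num)
    rw [WeierstrassCurve.b₈, Valuation.map_sub_eq_of_lt_right _ hlt, ha4sq]
  -- the root `x` is nonzero
  rw [eval_Ψ₃_eq] at hx
  have hx0 : x ≠ 0 := by
    rintro rfl
    have hb80 : X.b₈ = 0 := by simpa using hx
    have := hb₈'
    rw [hb80, map_zero] at this
    exact exp_ne_zero this.symm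
  obtain ⟨n, hn⟩ := val_exists_exp val hx0
  -- valuations of the five terms of `Ψ₃(x)`
  have hT₁ : val (3 * x ^ 4) = exp (4 * n - 1) := vmul_eq v3 (vpow_eq hn 4 rfl) (by ring)
  have hT₂ : val (X.b₂ * x ^ 3) ≤ exp (3 * n - 1) :=
    vmul_le hb₂ (vpow_eq hn 3 rfl).le (by ring_nf; rfl)
  have hT₃ : val (3 * X.b₄ * x ^ 2) ≤ exp (2 * n - 2) :=
    vmul_le (vmul_le v3.le hb₄ le_rfl) (vpow_eq hn 2 rfl).le (by ring_nf; rfl)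
  have hT₄ : val (3 * X.b₆ * x) ≤ exp (n - 3) :=
    vmul_le (vmul_le v3.le hb₆ le_rfl) hn.le (by ring_nf; rfl)
  rcases lt_trichotomy n 0 with hneg | hzero | hpos
  · -- `v₃(x) ≥ 1`: `b₈` dominates
    exfalso
    have hlt : val (3 * x ^ 4 + X.b₂ * x ^ 3 + 3 * X.b₄ * x ^ 2 + 3 * X.b₆ * x)
        < exp (-2 : ℤ) :=
      Valuation.map_add_lt _ (Valuation.map_add_lt _ (Valuation.map_add_lt _
        (vlt_of_le hT₁.le (by omega)) (vlt_of_le hT₂ (by omega))) (vlt_of_le hT₃ (by omega)))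
        (vlt_of_le hT₄ (by omega))
    have hsum := Valuation.map_add_eq_of_lt_right _ (hb₈'.symm ▸ hlt)
    rw [hx, map_zero, hb₈'] at hsum
    exact exp_ne_zero hsum.symm
  · -- `v₃(x) = 0`: `4x³` dominates `ψ₂²(x)`
    subst hzero
    refine ⟨hn, ?_⟩
    rw [Affine.Point.eval_Ψ₂Sq, show 4 * x ^ 3 + X.b₂ * x ^ 2 + 2 * X.b₄ * x + X.b₆ =
      4 * x ^ 3 + (X.b₂ * x ^ 2 + 2 * X.b₄ * x + X.b₆) by ring]
    have hlead : val (4 * x ^ 3) = exp (0 : ℤ) := vmul_eq v4 (vpow_eq hn 3 rfl) (by norm_num)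
    have hlt : val (X.b₂ * x ^ 2 + 2 * X.b₄ * x + X.b₆) < exp (0 : ℤ) :=
      Valuation.map_add_lt _ (Valuation.map_add_lt _
        (vlt_of_le (vmul_le hb₂ (vpow_eq hn 2 rfl).le le_rfl) (by norm_num))
        (vlt_of_le (vmul_le (vmul_le n2 hb₄ le_rfl) hn.le le_rfl) (by norm_num)))
        (vlt_of_le hb₆ (by norm_num))
    rw [Valuation.map_add_eq_of_lt_left _ (hlead.symm ▸ hlt), hlead]
  · -- `v₃(x) ≤ -1`: `3x⁴` dominates
    exfalso
    have hlt : val (X.b₂ * x ^ 3 + 3 * X.b₄ * x ^ 2 + 3 * X.b₆ * x + X.b₈)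
        < exp (4 * n - 1) :=
      Valuation.map_add_lt _ (Valuation.map_add_lt _ (Valuation.map_add_lt _
        (vlt_of_le hT₂ (by omega)) (vlt_of_le hT₃ (by omega))) (vlt_of_le hT₄ (by omega)))
        (vlt_of_le hb₈'.le (by omega))
    have e : 3 * x ^ 4 + X.b₂ * x ^ 3 + 3 * X.b₄ * x ^ 2 + 3 * X.b₆ * x + X.b₈ =
        3 * x ^ 4 + (X.b₂ * x ^ 3 + 3 * X.b₄ * x ^ 2 + 3 * X.b₆ * x + X.b₈) := by ring
    have hsum := Valuation.map_add_eq_of_lt_left _ (hT₁.symm ▸ hlt)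
    rw [← e, hx, map_zero, hT₁] at hsum
    exact exp_ne_zero hsum.symm

end NormalFormIII

section NormalFormIIIRat

open Rat.HeightOneSpectrum

variable (X : WeierstrassCurve ℚ) (v : HeightOneSpectrum ℤ)

/-- **On a type-III Tate normal form at `3`** over `ℚ` (`v` the place of `ℤ` over `3`): every rational
root `x₀` of `Ψ₃` is a `3`-adic unit and so is `ψ₂²(x₀)` (the case `L = ℚ`, `|·| = |·|_v` of
`valuation_root_Ψ₃_of_tateNormalForm_III`).
[cite: SilvermanATAEC1994, IV.9.4 Step 4 and Table 4.1 (type III)] [cite: SilvermanAEC2009, III Ex. 3.7] -/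
theorem valuation_Ψ₂Sq_eq_one_of_tateNormalForm_III
    (hv : ((primesEquiv (R := ℤ) v : Nat.Primes) : ℕ) = 3)
    (h₁ : v.valuation ℚ X.a₁ ≤ exp (-1 : ℤ)) (h₂ : v.valuation ℚ X.a₂ ≤ exp (-1 : ℤ))
    (h₃ : v.valuation ℚ X.a₃ ≤ exp (-1 : ℤ)) (h₄ : v.valuation ℚ X.a₄ ≤ exp (-1 : ℤ))
    (h₆ : v.valuation ℚ X.a₆ ≤ exp (-2 : ℤ)) (hΔ : v.valuation ℚ X.Δ = exp (-3 : ℤ))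
    {x : ℚ} (hx : X.Ψ₃.eval x = 0) :
    v.valuation ℚ x = exp (0 : ℤ) ∧ v.valuation ℚ (X.Ψ₂Sq.eval x) = exp (0 : ℤ) :=
  X.valuation_root_Ψ₃_of_tateNormalForm_III (v.valuation ℚ) (val_two v hv) (val_three v hv)
    h₁ h₂ h₃ h₄ h₆ hΔ hx

end NormalFormIIIRat

/-! ## §4. The type-III* normal form: `v₃(x₀) = 1` and `v₃(ψ₂²(x₀)) = 3` (any valued field with `|3| = exp(−1)`, `|2| = 1`) -/

section NormalFormIIIstar

variable {L : Type*} [Field L] (X : WeierstrassCurve L) (val : Valuation L ℤᵐ⁰)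

/-- **On a type-III* Tate normal form** over any field `L` with a valuation `|·| : L → ℤᵐ⁰`,
`|3| = exp(−1)`, `|2| = 1`, profile `v(a₁) ≥ 1`, `v(a₂) ≥ 2`, `v(a₃), v(a₄) ≥ 3`, `v(a₆) ≥ 5`,
`v(Δ) = 9` (Silverman *ATAEC* IV.9.4 Step 9): **every root `x₀ ∈ L` of `Ψ₃` has `v(x₀) = 1` and
`v(ψ₂²(x₀)) = 3`.** Bookkeeping: `v₃(b₂) ≥ 2`, `v₃(b₆) ≥ 5`, and `v₃(Δ) = 9` forces
`v₃(b₄) = 3`, `v₃(a₄) = 3`, `v₃(b₈) = 6`; in `Ψ₃(x₀) = 0` the term `b₈` (if `v₃(x₀) ≥ 2`) resp. `3x₀⁴`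
(if `v₃(x₀) ≤ 0`) would be the unique term of least valuation; then `v₃(ψ₂²(x₀)) = v₃(4x₀³) = 3`.
[cite: SilvermanATAEC1994, IV.9.4 Step 9 and Table 4.1 (type III*)] [cite: SilvermanAEC2009, III Ex. 3.7] -/
theorem valuation_root_Ψ₃_of_tateNormalForm_IIIstar (h2 : val 2 = 1) (h3 : val 3 = exp (-1 : ℤ))
    (h₁ : val X.a₁ ≤ exp (-1 : ℤ)) (h₂ : val X.a₂ ≤ exp (-2 : ℤ))
    (h₃ : val X.a₃ ≤ exp (-3 : ℤ)) (h₄ : val X.a₄ ≤ exp (-3 : ℤ))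
    (h₆ : val X.a₆ ≤ exp (-5 : ℤ)) (hΔ : val X.Δ = exp (-9 : ℤ))
    {x : L} (hx : X.Ψ₃.eval x = 0) :
    val x = exp (-1 : ℤ) ∧ val (X.Ψ₂Sq.eval x) = exp (-3 : ℤ) := by
  have v3 := h3
  have v4 : val (4 : L) = exp (0 : ℤ) := by
    rw [show (4 : L) = 2 * 2 by norm_num, map_mul, h2, mul_one, exp_zero]
  have n2 : val (2 : L) ≤ exp (0 : ℤ) := by rw [h2, exp_zero]
  have n4 : val (4 : L) ≤ exp (0 : ℤ) := v4.le
  have n8 : val (8 : L) ≤ exp (0 : ℤ) := by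
    rw [show (8 : L) = 2 * 2 * 2 by norm_num, map_mul, map_mul, h2, mul_one, mul_one, exp_zero]
  have n9 : val (9 : L) ≤ exp (0 : ℤ) := by
    rw [show (9 : L) = 3 * 3 by norm_num, map_mul, h3, ← exp_add, exp_le_exp]; norm_num
  have n27 : val (27 : L) ≤ exp (0 : ℤ) := by
    rw [show (27 : L) = 3 * 3 * 3 by norm_num, map_mul, map_mul, h3, ← exp_add, ← exp_add, exp_le_exp]
    norm_num
  -- the `b`-invariants
  have hb₂ : val X.b₂ ≤ exp (-2 : ℤ) := by
    rw [WeierstrassCurve.b₂]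
    exact Valuation.map_add_le _ (vpow_le h₁ 2 (by norm_num)) (vmul_le n4 h₂ (by norm_num))
  have hb₄ : val X.b₄ ≤ exp (-3 : ℤ) := by
    rw [WeierstrassCurve.b₄]
    exact Valuation.map_add_le _ (vmul_le n2 h₄ (by norm_num)) (vmul_le h₁ h₃ (by norm_num))
  have hb₆ : val X.b₆ ≤ exp (-5 : ℤ) := by
    rw [WeierstrassCurve.b₆]
    exact Valuation.map_add_le _ (vpow_le h₃ 2 (by norm_num)) (vmul_le n4 h₆ (by norm_num))
  have hR : val (X.a₁ ^ 2 * X.a₆ + 4 * X.a₂ * X.a₆ - X.a₁ * X.a₃ * X.a₄ + X.a₂ * X.a₃ ^ 2)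
      ≤ exp (-7 : ℤ) :=
    Valuation.map_add_le _
      (Valuation.map_sub_le _
        (Valuation.map_add_le _ (vmul_le (vpow_le h₁ 2 le_rfl) h₆ (by norm_num))
          (vmul_le (vmul_le n4 h₂ le_rfl) h₆ (by norm_num)))
        (vmul_le (vmul_le h₁ h₃ le_rfl) h₄ (by norm_num)))
      (vmul_le h₂ (vpow_le h₃ 2 le_rfl) (by norm_num))
  have hb₈ : val X.b₈ ≤ exp (-6 : ℤ) := by
    rw [WeierstrassCurve.b₈]
    exact Valuation.map_sub_le _ (vle_mono hR (by norm_num)) (vpow_le h₄ 2 (by norm_num))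
  -- `v₃(b₄) = 3` exactly, from `v₃(Δ) = 9`
  have hb₄' : val X.b₄ = exp (-3 : ℤ) := by
    refine val_eq_exp_of_le_of_not_le val hb₄ fun hb => ?_
    have hΔle : val X.Δ ≤ exp (-10 : ℤ) := by
      rw [WeierstrassCurve.Δ]
      refine Valuation.map_add_le _ (Valuation.map_sub_le _ (Valuation.map_sub_le _ ?_ ?_) ?_) ?_
      · exact vmul_le (vneg_le (vpow_le hb₂ 2 le_rfl)) hb₈ (by norm_num)
      · exact vmul_le n8 (vpow_le hb 3 le_rfl) (by norm_num)
      · exact vmul_le n27 (vpow_le hb₆ 2 le_rfl) (by norm_num)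
      · exact vmul_le (vmul_le (vmul_le n9 hb₂ le_rfl) hb le_rfl) hb₆ (by norm_num)
    rw [hΔ, exp_le_exp] at hΔle
    omega
  -- `v₃(a₄) = 3` exactly
  have ha₄' : val X.a₄ = exp (-3 : ℤ) := by
    refine val_eq_exp_of_le_of_not_le val h₄ fun ha => ?_
    have : val X.b₄ ≤ exp (-4 : ℤ) := by
      rw [WeierstrassCurve.b₄]
      exact Valuation.map_add_le _ (vmul_le n2 ha (by norm_num)) (vmul_le h₁ h₃ (by norm_num))
    rw [hb₄', exp_le_exp] at this
    omega
  -- `v₃(b₈) = 6` exactly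
  have ha4sq : val (X.a₄ ^ 2) = exp (-6 : ℤ) := vpow_eq ha₄' 2 (by norm_num)
  have hb₈' : val X.b₈ = exp (-6 : ℤ) := by
    have hlt : val (X.a₁ ^ 2 * X.a₆ + 4 * X.a₂ * X.a₆ - X.a₁ * X.a₃ * X.a₄ + X.a₂ * X.a₃ ^ 2)
        < val (X.a₄ ^ 2) := by
      rw [ha4sq]; exact vlt_of_le hR (by norm_num)
    rw [WeierstrassCurve.b₈, Valuation.map_sub_eq_of_lt_right _ hlt, ha4sq]
  -- the root `x` is nonzero
  rw [eval_Ψ₃_eq] at hx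
  have hx0 : x ≠ 0 := by
    rintro rfl
    have hb80 : X.b₈ = 0 := by simpa using hx
    have := hb₈'
    rw [hb80, map_zero] at this
    exact exp_ne_zero this.symm
  obtain ⟨n, hn⟩ := val_exists_exp val hx0
  -- valuations of the five terms of `Ψ₃(x)`
  have hT₁ : val (3 * x ^ 4) = exp (4 * n - 1) := vmul_eq v3 (vpow_eq hn 4 rfl) (by ring)
  have hT₂ : val (X.b₂ * x ^ 3) ≤ exp (3 * n - 2) :=
    vmul_le hb₂ (vpow_eq hn 3 rfl).le (by ring_nf; rfl)
  have hT₃ : val (3 * X.b₄ * x ^ 2) ≤ exp (2 * n - 4) :=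
    vmul_le (vmul_le v3.le hb₄ le_rfl) (vpow_eq hn 2 rfl).le (by ring_nf; rfl)
  have hT₄ : val (3 * X.b₆ * x) ≤ exp (n - 6) :=
    vmul_le (vmul_le v3.le hb₆ le_rfl) hn.le (by ring_nf; rfl)
  rcases lt_trichotomy n (-1) with hneg | hmid | hpos
  · -- `v₃(x) ≥ 2`: `b₈` dominates
    exfalso
    have hlt : val (3 * x ^ 4 + X.b₂ * x ^ 3 + 3 * X.b₄ * x ^ 2 + 3 * X.b₆ * x)
        < exp (-6 : ℤ) :=
      Valuation.map_add_lt _ (Valuation.map_add_lt _ (Valuation.map_add_lt _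
        (vlt_of_le hT₁.le (by omega)) (vlt_of_le hT₂ (by omega))) (vlt_of_le hT₃ (by omega)))
        (vlt_of_le hT₄ (by omega))
    have hsum := Valuation.map_add_eq_of_lt_right _ (hb₈'.symm ▸ hlt)
    rw [hx, map_zero, hb₈'] at hsum
    exact exp_ne_zero hsum.symm
  · -- `v₃(x) = 1`: `4x³` dominates `ψ₂²(x)`
    subst hmid
    refine ⟨hn, ?_⟩
    rw [Affine.Point.eval_Ψ₂Sq, show 4 * x ^ 3 + X.b₂ * x ^ 2 + 2 * X.b₄ * x + X.b₆ =
      4 * x ^ 3 + (X.b₂ * x ^ 2 + 2 * X.b₄ * x + X.b₆) by ring]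
    have hlead : val (4 * x ^ 3) = exp (-3 : ℤ) :=
      vmul_eq v4 (vpow_eq hn 3 rfl) (by norm_num)
    have hlt : val (X.b₂ * x ^ 2 + 2 * X.b₄ * x + X.b₆) < exp (-3 : ℤ) :=
      Valuation.map_add_lt _ (Valuation.map_add_lt _
        (vlt_of_le (vmul_le hb₂ (vpow_eq hn 2 rfl).le le_rfl) (by norm_num))
        (vlt_of_le (vmul_le (vmul_le n2 hb₄ le_rfl) hn.le le_rfl) (by norm_num)))
        (vlt_of_le hb₆ (by norm_num))
    rw [Valuation.map_add_eq_of_lt_left _ (hlead.symm ▸ hlt), hlead]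
  · -- `v₃(x) ≤ 0`: `3x⁴` dominates
    exfalso
    have hlt : val (X.b₂ * x ^ 3 + 3 * X.b₄ * x ^ 2 + 3 * X.b₆ * x + X.b₈)
        < exp (4 * n - 1) :=
      Valuation.map_add_lt _ (Valuation.map_add_lt _ (Valuation.map_add_lt _
        (vlt_of_le hT₂ (by omega)) (vlt_of_le hT₃ (by omega))) (vlt_of_le hT₄ (by omega)))
        (vlt_of_le hb₈'.le (by omega))
    have e : 3 * x ^ 4 + X.b₂ * x ^ 3 + 3 * X.b₄ * x ^ 2 + 3 * X.b₆ * x + X.b₈ =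
        3 * x ^ 4 + (X.b₂ * x ^ 3 + 3 * X.b₄ * x ^ 2 + 3 * X.b₆ * x + X.b₈) := by ring
    have hsum := Valuation.map_add_eq_of_lt_left _ (hT₁.symm ▸ hlt)
    rw [← e, hx, map_zero, hT₁] at hsum
    exact exp_ne_zero hsum.symm

end NormalFormIIIstar


section NormalFormIIIstarRat

open Rat.HeightOneSpectrum

variable (X : WeierstrassCurve ℚ) (v : HeightOneSpectrum ℤ)

/-- **On a type-III* Tate normal form at `3`** over `ℚ`: every rational root `x₀` of `Ψ₃` has
`|x₀|_v = exp(−1)` and `|ψ₂²(x₀)|_v = exp(−3)` (the case `L = ℚ` of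
`valuation_root_Ψ₃_of_tateNormalForm_IIIstar`).
[cite: SilvermanATAEC1994, IV.9.4 Step 9 and Table 4.1 (type III*)] [cite: SilvermanAEC2009, III Ex. 3.7] -/
theorem valuation_Ψ₂Sq_eq_of_tateNormalForm_IIIstar
    (hv : ((primesEquiv (R := ℤ) v : Nat.Primes) : ℕ) = 3)
    (h₁ : v.valuation ℚ X.a₁ ≤ exp (-1 : ℤ)) (h₂ : v.valuation ℚ X.a₂ ≤ exp (-2 : ℤ))
    (h₃ : v.valuation ℚ X.a₃ ≤ exp (-3 : ℤ)) (h₄ : v.valuation ℚ X.a₄ ≤ exp (-3 : ℤ))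
    (h₆ : v.valuation ℚ X.a₆ ≤ exp (-5 : ℤ)) (hΔ : v.valuation ℚ X.Δ = exp (-9 : ℤ))
    {x : ℚ} (hx : X.Ψ₃.eval x = 0) :
    v.valuation ℚ x = exp (-1 : ℤ) ∧ v.valuation ℚ (X.Ψ₂Sq.eval x) = exp (-3 : ℤ) :=
  X.valuation_root_Ψ₃_of_tateNormalForm_IIIstar (v.valuation ℚ) (val_two v hv) (val_three v hv)
    h₁ h₂ h₃ h₄ h₆ hΔ hx

end NormalFormIIIstarRat

/-! ## §5. Transport to an arbitrary `ℚ`-model on the Kodaira III / III* rows at `3` -/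

section KodairaRows

open Rat.HeightOneSpectrum Literature.NumberTheory.DiophantineGeometry
  Literature.NumberTheory.EllipticCurves

variable (W : WeierstrassCurve ℚ) [W.IsElliptic] (v : HeightOneSpectrum ℤ)

/-- The residue ring `ℤ ⧸ v` has characteristic `natGenerator v` (as in the prequel). [folklore] -/
private theorem ringChar_int_quot_eq_natGenerator (v : HeightOneSpectrum ℤ) :
    ringChar (ℤ ⧸ v.asIdeal) = natGenerator v := by
  have hmem : (natGenerator v : ℤ) ∈ v.asIdeal := by
    rw [asIdeal_eq_span_natGenerator_int]; exact Ideal.mem_span_singleton_self _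
  haveI : Nontrivial (ℤ ⧸ v.asIdeal) := Ideal.Quotient.nontrivial_iff.mpr v.isPrime.ne_top
  apply CharP.ringChar_of_prime_eq_zero (prime_natGenerator v)
  rw [← map_natCast (Ideal.Quotient.mk v.asIdeal), Ideal.Quotient.eq_zero_iff_mem]
  exact hmem

/-- **Type III at `3` ⟹ `|ψ₂²(x₀)|₃ = |u|₃⁶` for some `u ∈ ℚˣ`**, for every rational root `x₀` of
`Ψ₃` and ANY `ℚ`-model `W` (transport of §3 along the prequel's rational Tate normal form
`exists_variableChange_tateNormalForm_III`, with the covariance §1; `u` is the scaling of that change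
of variables). [cite: SilvermanATAEC1994, IV.9.4 Step 4 (type III normal form)] [cite: BarriosRoy2022LocalData, Thm. 3.4 and Thm. 3.5 (rational 3-torsion: type III, f₃ = 2; arXiv:2104.10337 p. 14–15)] -/
theorem valuation_Ψ₂Sq_of_kodairaSymbolAt_eq_III
    (hv : ((primesEquiv (R := ℤ) v : Nat.Primes) : ℕ) = 3) (hK : W.kodairaSymbolAt v = .III)
    {x₀ : ℚ} (hx₀ : W.Ψ₃.eval x₀ = 0) :
    ∃ u : ℚ, u ≠ 0 ∧ v.valuation ℚ (W.Ψ₂Sq.eval x₀) = v.valuation ℚ u ^ 6 := by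
  haveI : PerfectField (IsLocalRing.ResidueField (v.adicCompletionIntegers ℚ)) :=
    PerfectField.ofFinite
  have hgen : natGenerator v = 3 := hv
  have h2 : ringChar (ℤ ⧸ v.asIdeal) ≠ 2 := by
    rw [ringChar_int_quot_eq_natGenerator v, hgen]; decide
  obtain ⟨C, c₁, c₂, c₃, c₄, c₆, cΔ⟩ := W.exists_variableChange_tateNormalForm_III v h2 hK
  have hx' : (C • W).Ψ₃.eval (((C.u⁻¹ : ℚˣ) : ℚ) ^ 2 * (x₀ - C.r)) = 0 := by
    rw [eval_Ψ₃_variableChange, hx₀, mul_zero]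
  obtain ⟨-, hD⟩ :=
    (C • W).valuation_Ψ₂Sq_eq_one_of_tateNormalForm_III v hv c₁ c₂ c₃ c₄ c₆ cΔ hx'
  rw [eval_Ψ₂Sq_variableChange, map_mul, map_pow, exp_zero] at hD
  refine ⟨(C.u : ℚ), C.u.ne_zero, ?_⟩
  have hu : v.valuation ℚ ((C.u⁻¹ : ℚˣ) : ℚ) * v.valuation ℚ (C.u : ℚ) = 1 := by
    rw [← map_mul, Units.inv_mul, map_one]
  calc v.valuation ℚ (W.Ψ₂Sq.eval x₀)
      = (v.valuation ℚ ((C.u⁻¹ : ℚˣ) : ℚ) * v.valuation ℚ (C.u : ℚ)) ^ 6 *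
          v.valuation ℚ (W.Ψ₂Sq.eval x₀) := by rw [hu, one_pow, one_mul]
    _ = v.valuation ℚ (C.u : ℚ) ^ 6 *
          (v.valuation ℚ ((C.u⁻¹ : ℚˣ) : ℚ) ^ 6 * v.valuation ℚ (W.Ψ₂Sq.eval x₀)) := by
          rw [mul_pow, mul_comm (v.valuation ℚ ((C.u⁻¹ : ℚˣ) : ℚ) ^ 6), mul_assoc]
    _ = v.valuation ℚ (C.u : ℚ) ^ 6 := by rw [hD, mul_one]

/-- **Type III* at `3` ⟹ `|ψ₂²(x₀)|₃ = exp(−3)·|u|₃⁶` for some `u ∈ ℚˣ`**, for every rational root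
`x₀` of `Ψ₃` and any `ℚ`-model (transport of §4 along `exists_variableChange_tateNormalForm_IIIstar`).
[cite: SilvermanATAEC1994, IV.9.4 Step 9 (type III* normal form)] [cite: BarriosRoy2022LocalData, Thm. 3.5 (no type III* with a rational point of order 3; arXiv:2104.10337 p. 15)] -/
theorem valuation_Ψ₂Sq_of_kodairaSymbolAt_eq_IIIstar
    (hv : ((primesEquiv (R := ℤ) v : Nat.Primes) : ℕ) = 3) (hK : W.kodairaSymbolAt v = .IIIstar)
    {x₀ : ℚ} (hx₀ : W.Ψ₃.eval x₀ = 0) :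
    ∃ u : ℚ, u ≠ 0 ∧ v.valuation ℚ (W.Ψ₂Sq.eval x₀) = exp (-3 : ℤ) * v.valuation ℚ u ^ 6 := by
  haveI : PerfectField (IsLocalRing.ResidueField (v.adicCompletionIntegers ℚ)) :=
    PerfectField.ofFinite
  have hgen : natGenerator v = 3 := hv
  have h2 : ringChar (ℤ ⧸ v.asIdeal) ≠ 2 := by
    rw [ringChar_int_quot_eq_natGenerator v, hgen]; decide
  obtain ⟨C, c₁, c₂, c₃, c₄, c₆, cΔ⟩ := W.exists_variableChange_tateNormalForm_IIIstar v h2 hK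
  have hx' : (C • W).Ψ₃.eval (((C.u⁻¹ : ℚˣ) : ℚ) ^ 2 * (x₀ - C.r)) = 0 := by
    rw [eval_Ψ₃_variableChange, hx₀, mul_zero]
  obtain ⟨-, hD⟩ :=
    (C • W).valuation_Ψ₂Sq_eq_of_tateNormalForm_IIIstar v hv c₁ c₂ c₃ c₄ c₆ cΔ hx'
  rw [eval_Ψ₂Sq_variableChange, map_mul, map_pow] at hD
  refine ⟨(C.u : ℚ), C.u.ne_zero, ?_⟩
  have hu : v.valuation ℚ ((C.u⁻¹ : ℚˣ) : ℚ) * v.valuation ℚ (C.u : ℚ) = 1 := by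
    rw [← map_mul, Units.inv_mul, map_one]
  calc v.valuation ℚ (W.Ψ₂Sq.eval x₀)
      = (v.valuation ℚ ((C.u⁻¹ : ℚˣ) : ℚ) * v.valuation ℚ (C.u : ℚ)) ^ 6 *
          v.valuation ℚ (W.Ψ₂Sq.eval x₀) := by rw [hu, one_pow, one_mul]
    _ = v.valuation ℚ (C.u : ℚ) ^ 6 *
          (v.valuation ℚ ((C.u⁻¹ : ℚˣ) : ℚ) ^ 6 * v.valuation ℚ (W.Ψ₂Sq.eval x₀)) := by
          rw [mul_pow, mul_comm (v.valuation ℚ ((C.u⁻¹ : ℚˣ) : ℚ) ^ 6), mul_assoc]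
    _ = exp (-3 : ℤ) * v.valuation ℚ (C.u : ℚ) ^ 6 := by rw [hD, mul_comm]

/-- **Type III at `3`: `v₃(ψ₂²(x₀)) = 6·v₃(u)`** (in particular `ψ₂²(x₀) ≠ 0`, and the quadratic
character `χ_{ψ₂²(x₀)}` of the kernel `{O, ±(x₀, y₀)}` is unramified at `3`).
[cite: BarriosRoy2022LocalData, Thm. 3.4 and Thm. 3.5 (arXiv:2104.10337 p. 14–15)] [cite: SilvermanAEC2009, III Ex. 3.7] -/
theorem padicValRat_Ψ₂Sq_eq_of_kodairaSymbolAt_eq_III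
    (hv : ((primesEquiv (R := ℤ) v : Nat.Primes) : ℕ) = 3) (hK : W.kodairaSymbolAt v = .III)
    {x₀ : ℚ} (hx₀ : W.Ψ₃.eval x₀ = 0) :
    ∃ u : ℚ, u ≠ 0 ∧ W.Ψ₂Sq.eval x₀ ≠ 0 ∧
      padicValRat 3 (W.Ψ₂Sq.eval x₀) = 6 * padicValRat 3 u := by
  obtain ⟨u, hu0, hval⟩ := W.valuation_Ψ₂Sq_of_kodairaSymbolAt_eq_III v hv hK hx₀
  have hgen : natGenerator v = 3 := hv
  have hD0 : W.Ψ₂Sq.eval x₀ ≠ 0 := by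
    intro h0
    rw [h0, map_zero] at hval
    exact pow_ne_zero 6 ((Valuation.ne_zero_iff _).mpr hu0) hval.symm
  refine ⟨u, hu0, hD0, ?_⟩
  rw [valuation_eq_exp_neg_padicValRat v hD0, valuation_eq_exp_neg_padicValRat v hu0, hgen,
    ← exp_nsmul, exp_inj, smul_neg, nsmul_eq_mul] at hval
  push_cast at hval
  omega

/-- **Type III* at `3`: `v₃(ψ₂²(x₀)) = 3 + 6·v₃(u)`** (in particular the character `χ_{ψ₂²(x₀)}` of
the kernel is RAMIFIED at `3` — the `μ₃`-type side). [cite: BarriosRoy2022LocalData, Thm. 3.5 (arXiv:2104.10337 p. 15)] [cite: SilvermanAEC2009, III Ex. 3.7] -/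
theorem padicValRat_Ψ₂Sq_eq_of_kodairaSymbolAt_eq_IIIstar
    (hv : ((primesEquiv (R := ℤ) v : Nat.Primes) : ℕ) = 3) (hK : W.kodairaSymbolAt v = .IIIstar)
    {x₀ : ℚ} (hx₀ : W.Ψ₃.eval x₀ = 0) :
    ∃ u : ℚ, u ≠ 0 ∧ W.Ψ₂Sq.eval x₀ ≠ 0 ∧
      padicValRat 3 (W.Ψ₂Sq.eval x₀) = 3 + 6 * padicValRat 3 u := by
  obtain ⟨u, hu0, hval⟩ := W.valuation_Ψ₂Sq_of_kodairaSymbolAt_eq_IIIstar v hv hK hx₀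
  have hgen : natGenerator v = 3 := hv
  have hD0 : W.Ψ₂Sq.eval x₀ ≠ 0 := by
    intro h0
    rw [h0, map_zero] at hval
    exact mul_ne_zero exp_ne_zero (pow_ne_zero 6 ((Valuation.ne_zero_iff _).mpr hu0)) hval.symm
  refine ⟨u, hu0, hD0, ?_⟩
  rw [valuation_eq_exp_neg_padicValRat v hD0, valuation_eq_exp_neg_padicValRat v hu0, hgen,
    ← exp_nsmul, ← exp_add, exp_inj, smul_neg, nsmul_eq_mul] at hval
  push_cast at hval
  omega

/-- **Type III at `3` ⟹ `v₃(ψ₂²(x₀))` is even.** [cite: BarriosRoy2022LocalData, Thm. 3.4 and Thm. 3.5] -/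
theorem even_padicValRat_Ψ₂Sq_of_kodairaSymbolAt_eq_III
    (hv : ((primesEquiv (R := ℤ) v : Nat.Primes) : ℕ) = 3) (hK : W.kodairaSymbolAt v = .III)
    {x₀ : ℚ} (hx₀ : W.Ψ₃.eval x₀ = 0) : Even (padicValRat 3 (W.Ψ₂Sq.eval x₀)) := by
  obtain ⟨u, -, -, h⟩ := W.padicValRat_Ψ₂Sq_eq_of_kodairaSymbolAt_eq_III v hv hK hx₀
  exact ⟨3 * padicValRat 3 u, by rw [h]; ring⟩

/-- **Type III* at `3` ⟹ `v₃(ψ₂²(x₀))` is odd.** [cite: BarriosRoy2022LocalData, Thm. 3.5] -/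
theorem odd_padicValRat_Ψ₂Sq_of_kodairaSymbolAt_eq_IIIstar
    (hv : ((primesEquiv (R := ℤ) v : Nat.Primes) : ℕ) = 3) (hK : W.kodairaSymbolAt v = .IIIstar)
    {x₀ : ℚ} (hx₀ : W.Ψ₃.eval x₀ = 0) : Odd (padicValRat 3 (W.Ψ₂Sq.eval x₀)) := by
  obtain ⟨u, -, -, h⟩ := W.padicValRat_Ψ₂Sq_eq_of_kodairaSymbolAt_eq_IIIstar v hv hK hx₀
  exact ⟨1 + 3 * padicValRat 3 u, by rw [h]; ring⟩

/-- **The dictionary on the III / III* rows at `3`: `v₃(ψ₂²(x₀))` even ⟺ type III** (for any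
rational root `x₀` of `Ψ₃`, any `ℚ`-model). [cite: BarriosRoy2022LocalData, Thm. 3.4 and Thm. 3.5 (arXiv:2104.10337 p. 14–15)] -/
theorem even_padicValRat_Ψ₂Sq_iff_kodairaSymbolAt_eq_III
    (hv : ((primesEquiv (R := ℤ) v : Nat.Primes) : ℕ) = 3)
    (hK : W.kodairaSymbolAt v = .III ∨ W.kodairaSymbolAt v = .IIIstar)
    {x₀ : ℚ} (hx₀ : W.Ψ₃.eval x₀ = 0) :
    Even (padicValRat 3 (W.Ψ₂Sq.eval x₀)) ↔ W.kodairaSymbolAt v = .III := by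
  rcases hK with hK | hK
  · exact ⟨fun _ => hK, fun _ => W.even_padicValRat_Ψ₂Sq_of_kodairaSymbolAt_eq_III v hv hK hx₀⟩
  · refine ⟨fun he => ?_, fun hIII => ?_⟩
    · exact absurd (W.odd_padicValRat_Ψ₂Sq_of_kodairaSymbolAt_eq_IIIstar v hv hK hx₀)
        (Int.not_odd_iff_even.mpr he)
    · rw [hK] at hIII; exact absurd hIII (by decide)

/-- **L14a, Literature form: on the III / III* rows at `3`,
`v₃(4x₀³ + b₂x₀² + 2b₄x₀ + b₆)` is even ⟺ `ord₃ Δ_min = 3`** (for any rational root `x₀` of `Ψ₃` and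
any `ℚ`-model `W`; `ord₃ Δ_min = 3` on III and `= 9` on III*, Silverman *ATAEC* Table 4.1). This is
`TprimeKernelUnramifiedIffKodairaThree` of route `TameQuarticManinParity` once `Addv W 3 ∧ SubTprime W 3`
is read as "Kodaira III or III* at `3`". [cite: BarriosRoy2022LocalData, Thm. 3.4 and Thm. 3.5 (arXiv:2104.10337 p. 14–15)] [cite: SilvermanATAEC1994, IV Table 4.1 (ord Δ = 3, 9 on III, III*)] -/
theorem even_padicValRat_iff_ordMinimalDiscriminant_eq_three
    (hv : ((primesEquiv (R := ℤ) v : Nat.Primes) : ℕ) = 3)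
    (hK : W.kodairaSymbolAt v = .III ∨ W.kodairaSymbolAt v = .IIIstar)
    {x₀ : ℚ} (hx₀ : W.Ψ₃.eval x₀ = 0) :
    Even (padicValRat 3 (4 * x₀ ^ 3 + W.b₂ * x₀ ^ 2 + 2 * W.b₄ * x₀ + W.b₆)) ↔
      W.ordMinimalDiscriminant v = 3 := by
  haveI : PerfectField (IsLocalRing.ResidueField (v.adicCompletionIntegers ℚ)) :=
    PerfectField.ofFinite
  have hgen : natGenerator v = 3 := hv
  have h2 : ringChar (ℤ ⧸ v.asIdeal) ≠ 2 := by
    rw [ringChar_int_quot_eq_natGenerator v, hgen]; decide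
  have hn := W.ordMinimalDiscriminant_eq_numComponentsAt_add_one_of_kodairaSymbolAt v h2
    (hK.elim Or.inl fun h9 => Or.inr (Or.inl h9))
  unfold WeierstrassCurve.numComponentsAt at hn
  rw [← Affine.Point.eval_Ψ₂Sq, W.even_padicValRat_Ψ₂Sq_iff_kodairaSymbolAt_eq_III v hv hK hx₀, hn]
  rcases hK with hK | hK <;> rw [hK] <;> decide

/-- **Corollary (both rows): `ψ₂²(x₀) ≠ 0` and the kernel field `ℚ(√ψ₂²(x₀))` is a genuine
invariant** — recorded as: on the III / III* rows at `3` every rational root `x₀` of `Ψ₃` has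
`4x₀³ + b₂x₀² + 2b₄x₀ + b₆ ≠ 0`. [cite: SilvermanAEC2009, III Ex. 3.7] -/
theorem Ψ₂Sq_eval_ne_zero_of_kodairaSymbolAt_eq_III_or_IIIstar
    (hv : ((primesEquiv (R := ℤ) v : Nat.Primes) : ℕ) = 3)
    (hK : W.kodairaSymbolAt v = .III ∨ W.kodairaSymbolAt v = .IIIstar)
    {x₀ : ℚ} (hx₀ : W.Ψ₃.eval x₀ = 0) :
    4 * x₀ ^ 3 + W.b₂ * x₀ ^ 2 + 2 * W.b₄ * x₀ + W.b₆ ≠ 0 := by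
  rw [← Affine.Point.eval_Ψ₂Sq]
  rcases hK with hK | hK
  · obtain ⟨-, -, h, -⟩ := W.padicValRat_Ψ₂Sq_eq_of_kodairaSymbolAt_eq_III v hv hK hx₀
    exact h
  · obtain ⟨-, -, h, -⟩ := W.padicValRat_Ψ₂Sq_eq_of_kodairaSymbolAt_eq_IIIstar v hv hK hx₀
    exact h

end KodairaRows


/-! ## §6. The LOCAL law: roots of `Ψ₃` in a valued extension `L ⊇ ℚ` whose valuation restricts to
`|·|_v` (e.g. `L = ℚᵥ ≅ ℚ₃`): the `Gal(L̄/L)`-stable `3`-kernels on the III / III* rows at `3` -/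

section LocalRows

open Rat.HeightOneSpectrum Literature.NumberTheory.DiophantineGeometry
  Literature.NumberTheory.EllipticCurves

variable (W : WeierstrassCurve ℚ) [W.IsElliptic] (v : HeightOneSpectrum ℤ)
  {L : Type*} [Field L] [Algebra ℚ L] (val : Valuation L ℤᵐ⁰)

/-- **Type III at `3`, local form**: for any field `L ⊇ ℚ` with a valuation `|·|` extending `|·|_v`
(`v` the place over `3`) and any root `x₀ ∈ L` of `Ψ₃` (the abscissa of an `L`-rational `3`-kernel),
`|ψ₂²(x₀)| = |u|_v⁶` for some `u ∈ ℚˣ`. The case `L = ℚ₃`: the `G_{ℚ₃}`-stable line of `E[3]`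
(present whenever `ρ̄_{E,3}|G₃` is reducible) has quadratic character `χ_D`, `D = ψ₂²(x₀)`, with
`v₃(D)` EVEN, i.e. UNRAMIFIED — the shape `(1 ∗; 0 ω)` on type III.
[cite: SilvermanATAEC1994, IV.9.4 Step 4 (type III normal form)] [cite: BarriosRoy2022LocalData, Thm. 3.4 and Thm. 3.5 (arXiv:2104.10337 p. 14–15)] -/
theorem valuation_Ψ₂Sq_baseChange_of_kodairaSymbolAt_eq_III
    (hv : ((primesEquiv (R := ℤ) v : Nat.Primes) : ℕ) = 3) (hK : W.kodairaSymbolAt v = .III)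
    (hval : ∀ a : ℚ, val (algebraMap ℚ L a) = v.valuation ℚ a)
    {x₀ : L} (hx₀ : (W.baseChange L).Ψ₃.eval x₀ = 0) :
    ∃ u : ℚ, u ≠ 0 ∧ val ((W.baseChange L).Ψ₂Sq.eval x₀) = v.valuation ℚ u ^ 6 := by
  haveI : PerfectField (IsLocalRing.ResidueField (v.adicCompletionIntegers ℚ)) :=
    PerfectField.ofFinite
  have hgen : natGenerator v = 3 := hv
  have h2 : ringChar (ℤ ⧸ v.asIdeal) ≠ 2 := by
    rw [ringChar_int_quot_eq_natGenerator v, hgen]; decide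
  obtain ⟨C, c₁, c₂, c₃, c₄, c₆, cΔ⟩ := W.exists_variableChange_tateNormalForm_III v h2 hK
  set φ := algebraMap ℚ L with hφ
  set C' : VariableChange L := C.map φ with hC'
  have hX : (C • W).baseChange L = C' • W.baseChange L := by
    rw [baseChange, baseChange, ← map_variableChange]
  have hv2 : val (2 : L) = 1 := by rw [← map_ofNat φ 2, hval, val_two v hv]
  have hv3 : val (3 : L) = exp (-1 : ℤ) := by rw [← map_ofNat φ 3, hval, val_three v hv]
  have e₁ : val (C' • W.baseChange L).a₁ ≤ exp (-1 : ℤ) := by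
    rw [← hX, baseChange, map_a₁, hval]; exact c₁
  have e₂ : val (C' • W.baseChange L).a₂ ≤ exp (-1 : ℤ) := by
    rw [← hX, baseChange, map_a₂, hval]; exact c₂
  have e₃ : val (C' • W.baseChange L).a₃ ≤ exp (-1 : ℤ) := by
    rw [← hX, baseChange, map_a₃, hval]; exact c₃
  have e₄ : val (C' • W.baseChange L).a₄ ≤ exp (-1 : ℤ) := by
    rw [← hX, baseChange, map_a₄, hval]; exact c₄
  have e₆ : val (C' • W.baseChange L).a₆ ≤ exp (-2 : ℤ) := by
    rw [← hX, baseChange, map_a₆, hval]; exact c₆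
  have eΔ : val (C' • W.baseChange L).Δ = exp (-3 : ℤ) := by
    rw [← hX, baseChange, map_Δ, hval]; exact cΔ
  have hx' : (C' • W.baseChange L).Ψ₃.eval (((C'.u⁻¹ : Lˣ) : L) ^ 2 * (x₀ - C'.r)) = 0 := by
    rw [eval_Ψ₃_variableChange, hx₀, mul_zero]
  obtain ⟨-, hD⟩ := (C' • W.baseChange L).valuation_root_Ψ₃_of_tateNormalForm_III val hv2 hv3
    e₁ e₂ e₃ e₄ e₆ eΔ hx'
  rw [eval_Ψ₂Sq_variableChange, map_mul, map_pow, exp_zero] at hD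
  refine ⟨(C.u : ℚ), C.u.ne_zero, ?_⟩
  have hCu : ((C'.u : Lˣ) : L) = φ (C.u : ℚ) := by simp [hC']
  have hu : val ((C'.u⁻¹ : Lˣ) : L) * val ((C'.u : Lˣ) : L) = 1 := by
    rw [← map_mul, Units.inv_mul, map_one]
  calc val ((W.baseChange L).Ψ₂Sq.eval x₀)
      = (val ((C'.u⁻¹ : Lˣ) : L) * val ((C'.u : Lˣ) : L)) ^ 6 *
          val ((W.baseChange L).Ψ₂Sq.eval x₀) := by rw [hu, one_pow, one_mul]
    _ = val ((C'.u : Lˣ) : L) ^ 6 *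
          (val ((C'.u⁻¹ : Lˣ) : L) ^ 6 * val ((W.baseChange L).Ψ₂Sq.eval x₀)) := by
          rw [mul_pow, mul_comm (val ((C'.u⁻¹ : Lˣ) : L) ^ 6), mul_assoc]
    _ = v.valuation ℚ (C.u : ℚ) ^ 6 := by rw [hD, mul_one, hCu, hval]

/-- **Type III* at `3`, local form**: `|ψ₂²(x₀)| = exp(−3)·|u|_v⁶` for any root `x₀ ∈ L` of `Ψ₃`
(`L ⊇ ℚ` valued compatibly with `|·|_v`). The case `L = ℚ₃`: the `G_{ℚ₃}`-stable `3`-kernel has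
RAMIFIED quadratic character (`ω` on inertia) — the shape `(ω ∗; 0 1)` on type III*.
[cite: SilvermanATAEC1994, IV.9.4 Step 9 (type III* normal form)] [cite: BarriosRoy2022LocalData, Thm. 3.5 (arXiv:2104.10337 p. 15)] -/
theorem valuation_Ψ₂Sq_baseChange_of_kodairaSymbolAt_eq_IIIstar
    (hv : ((primesEquiv (R := ℤ) v : Nat.Primes) : ℕ) = 3) (hK : W.kodairaSymbolAt v = .IIIstar)
    (hval : ∀ a : ℚ, val (algebraMap ℚ L a) = v.valuation ℚ a)
    {x₀ : L} (hx₀ : (W.baseChange L).Ψ₃.eval x₀ = 0) :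
    ∃ u : ℚ, u ≠ 0 ∧ val ((W.baseChange L).Ψ₂Sq.eval x₀) = exp (-3 : ℤ) * v.valuation ℚ u ^ 6 := by
  haveI : PerfectField (IsLocalRing.ResidueField (v.adicCompletionIntegers ℚ)) :=
    PerfectField.ofFinite
  have hgen : natGenerator v = 3 := hv
  have h2 : ringChar (ℤ ⧸ v.asIdeal) ≠ 2 := by
    rw [ringChar_int_quot_eq_natGenerator v, hgen]; decide
  obtain ⟨C, c₁, c₂, c₃, c₄, c₆, cΔ⟩ := W.exists_variableChange_tateNormalForm_IIIstar v h2 hK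
  set φ := algebraMap ℚ L with hφ
  set C' : VariableChange L := C.map φ with hC'
  have hX : (C • W).baseChange L = C' • W.baseChange L := by
    rw [baseChange, baseChange, ← map_variableChange]
  have hv2 : val (2 : L) = 1 := by rw [← map_ofNat φ 2, hval, val_two v hv]
  have hv3 : val (3 : L) = exp (-1 : ℤ) := by rw [← map_ofNat φ 3, hval, val_three v hv]
  have e₁ : val (C' • W.baseChange L).a₁ ≤ exp (-1 : ℤ) := by
    rw [← hX, baseChange, map_a₁, hval]; exact c₁
  have e₂ : val (C' • W.baseChange L).a₂ ≤ exp (-2 : ℤ) := by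
    rw [← hX, baseChange, map_a₂, hval]; exact c₂
  have e₃ : val (C' • W.baseChange L).a₃ ≤ exp (-3 : ℤ) := by
    rw [← hX, baseChange, map_a₃, hval]; exact c₃
  have e₄ : val (C' • W.baseChange L).a₄ ≤ exp (-3 : ℤ) := by
    rw [← hX, baseChange, map_a₄, hval]; exact c₄
  have e₆ : val (C' • W.baseChange L).a₆ ≤ exp (-5 : ℤ) := by
    rw [← hX, baseChange, map_a₆, hval]; exact c₆
  have eΔ : val (C' • W.baseChange L).Δ = exp (-9 : ℤ) := by
    rw [← hX, baseChange, map_Δ, hval]; exact cΔ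
  have hx' : (C' • W.baseChange L).Ψ₃.eval (((C'.u⁻¹ : Lˣ) : L) ^ 2 * (x₀ - C'.r)) = 0 := by
    rw [eval_Ψ₃_variableChange, hx₀, mul_zero]
  obtain ⟨-, hD⟩ := (C' • W.baseChange L).valuation_root_Ψ₃_of_tateNormalForm_IIIstar val hv2 hv3
    e₁ e₂ e₃ e₄ e₆ eΔ hx'
  rw [eval_Ψ₂Sq_variableChange, map_mul, map_pow] at hD
  refine ⟨(C.u : ℚ), C.u.ne_zero, ?_⟩
  have hCu : ((C'.u : Lˣ) : L) = φ (C.u : ℚ) := by simp [hC']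
  have hu : val ((C'.u⁻¹ : Lˣ) : L) * val ((C'.u : Lˣ) : L) = 1 := by
    rw [← map_mul, Units.inv_mul, map_one]
  calc val ((W.baseChange L).Ψ₂Sq.eval x₀)
      = (val ((C'.u⁻¹ : Lˣ) : L) * val ((C'.u : Lˣ) : L)) ^ 6 *
          val ((W.baseChange L).Ψ₂Sq.eval x₀) := by rw [hu, one_pow, one_mul]
    _ = val ((C'.u : Lˣ) : L) ^ 6 *
          (val ((C'.u⁻¹ : Lˣ) : L) ^ 6 * val ((W.baseChange L).Ψ₂Sq.eval x₀)) := by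
          rw [mul_pow, mul_comm (val ((C'.u⁻¹ : Lˣ) : L) ^ 6), mul_assoc]
    _ = exp (-3 : ℤ) * v.valuation ℚ (C.u : ℚ) ^ 6 := by rw [hD, mul_comm, hCu, hval]

/-- **Type III at `3`, local parity form**: `|ψ₂²(x₀)| = exp(2m)` for some `m ∈ ℤ` (even exponent:
the `L`-rational `3`-kernel has unramified quadratic character). [cite: BarriosRoy2022LocalData, Thm. 3.4 and Thm. 3.5] -/
theorem valuation_Ψ₂Sq_baseChange_eq_exp_even_of_kodairaSymbolAt_eq_III
    (hv : ((primesEquiv (R := ℤ) v : Nat.Primes) : ℕ) = 3) (hK : W.kodairaSymbolAt v = .III)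
    (hval : ∀ a : ℚ, val (algebraMap ℚ L a) = v.valuation ℚ a)
    {x₀ : L} (hx₀ : (W.baseChange L).Ψ₃.eval x₀ = 0) :
    ∃ m : ℤ, val ((W.baseChange L).Ψ₂Sq.eval x₀) = exp (2 * m) := by
  obtain ⟨u, hu0, h⟩ := W.valuation_Ψ₂Sq_baseChange_of_kodairaSymbolAt_eq_III v val hv hK hval hx₀
  have hgen : natGenerator v = 3 := hv
  refine ⟨-(3 * padicValRat 3 u), ?_⟩
  rw [h, valuation_eq_exp_neg_padicValRat v hu0, hgen, ← exp_nsmul, nsmul_eq_mul]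
  congr 1
  push_cast
  ring

/-- **Type III* at `3`, local parity form**: `|ψ₂²(x₀)| = exp(2m + 1)` for some `m ∈ ℤ` (odd
exponent: ramified quadratic character). [cite: BarriosRoy2022LocalData, Thm. 3.5] -/
theorem valuation_Ψ₂Sq_baseChange_eq_exp_odd_of_kodairaSymbolAt_eq_IIIstar
    (hv : ((primesEquiv (R := ℤ) v : Nat.Primes) : ℕ) = 3) (hK : W.kodairaSymbolAt v = .IIIstar)
    (hval : ∀ a : ℚ, val (algebraMap ℚ L a) = v.valuation ℚ a)
    {x₀ : L} (hx₀ : (W.baseChange L).Ψ₃.eval x₀ = 0) :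
    ∃ m : ℤ, val ((W.baseChange L).Ψ₂Sq.eval x₀) = exp (2 * m + 1) := by
  obtain ⟨u, hu0, h⟩ :=
    W.valuation_Ψ₂Sq_baseChange_of_kodairaSymbolAt_eq_IIIstar v val hv hK hval hx₀
  have hgen : natGenerator v = 3 := hv
  refine ⟨-(3 * padicValRat 3 u) - 2, ?_⟩
  rw [h, valuation_eq_exp_neg_padicValRat v hu0, hgen, ← exp_nsmul, ← exp_add, nsmul_eq_mul]
  congr 1
  push_cast
  ring

/-- **The local dictionary on the III / III* rows at `3`**: for `L ⊇ ℚ` valued compatibly with `|·|_v`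
and any root `x₀ ∈ L` of `Ψ₃`, `|ψ₂²(x₀)|` has EVEN exponent ⟺ type III (and odd ⟺ III*). With
`L = ℚ₃` this is the orientation of the `G_{ℚ₃}`-stable `3`-kernel: unramified character on III,
character `ω` on inertia on III*. [cite: BarriosRoy2022LocalData, Thm. 3.4 and Thm. 3.5 (arXiv:2104.10337 p. 14–15)] -/
theorem valuation_Ψ₂Sq_baseChange_even_iff_kodairaSymbolAt_eq_III
    (hv : ((primesEquiv (R := ℤ) v : Nat.Primes) : ℕ) = 3)
    (hK : W.kodairaSymbolAt v = .III ∨ W.kodairaSymbolAt v = .IIIstar)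
    (hval : ∀ a : ℚ, val (algebraMap ℚ L a) = v.valuation ℚ a)
    {x₀ : L} (hx₀ : (W.baseChange L).Ψ₃.eval x₀ = 0) :
    (∃ m : ℤ, val ((W.baseChange L).Ψ₂Sq.eval x₀) = exp (2 * m)) ↔ W.kodairaSymbolAt v = .III := by
  rcases hK with hK | hK
  · exact ⟨fun _ => hK, fun _ =>
      W.valuation_Ψ₂Sq_baseChange_eq_exp_even_of_kodairaSymbolAt_eq_III v val hv hK hval hx₀⟩
  · refine ⟨fun ⟨m, hm⟩ => ?_, fun hIII => ?_⟩
    · obtain ⟨m', hm'⟩ :=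
        W.valuation_Ψ₂Sq_baseChange_eq_exp_odd_of_kodairaSymbolAt_eq_IIIstar v val hv hK hval hx₀
      rw [hm, exp_inj] at hm'
      omega
    · rw [hK] at hIII; exact absurd hIII (by decide)

/-- **On the III / III* rows at `3`, `ψ₂²(x₀) ≠ 0` for every root `x₀ ∈ L` of `Ψ₃`** (`L ⊇ ℚ`
valued compatibly with `|·|_v`). [cite: SilvermanAEC2009, III Ex. 3.7] -/
theorem Ψ₂Sq_baseChange_eval_ne_zero_of_kodairaSymbolAt_eq_III_or_IIIstar
    (hv : ((primesEquiv (R := ℤ) v : Nat.Primes) : ℕ) = 3)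
    (hK : W.kodairaSymbolAt v = .III ∨ W.kodairaSymbolAt v = .IIIstar)
    (hval : ∀ a : ℚ, val (algebraMap ℚ L a) = v.valuation ℚ a)
    {x₀ : L} (hx₀ : (W.baseChange L).Ψ₃.eval x₀ = 0) :
    (W.baseChange L).Ψ₂Sq.eval x₀ ≠ 0 := by
  intro h0
  rcases hK with hK | hK
  · obtain ⟨m, hm⟩ :=
      W.valuation_Ψ₂Sq_baseChange_eq_exp_even_of_kodairaSymbolAt_eq_III v val hv hK hval hx₀
    rw [h0, map_zero] at hm
    exact exp_ne_zero hm.symm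
  · obtain ⟨m, hm⟩ :=
      W.valuation_Ψ₂Sq_baseChange_eq_exp_odd_of_kodairaSymbolAt_eq_IIIstar v val hv hK hval hx₀
    rw [h0, map_zero] at hm
    exact exp_ne_zero hm.symm

/-- **The local law in the completion `ℚᵥ` (`v` the place over `3`, `ℚᵥ ≅ ℚ₃`)**: for every root
`x₀ ∈ ℚᵥ` of `Ψ₃` — i.e. every `G_{ℚ₃}`-stable `3`-kernel `{O, ±P}` of `E`, `x(P) = x₀` — the valuation of
`D = ψ₂²(x₀) = (2y(P) + a₁x₀ + a₃)²` has EVEN exponent iff `E` is of type III at `3`, ODD iff III*: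
the kernel's quadratic character `χ_D` is unramified on III and ramified (`= ω` on `I₃`) on III*.
[cite: BarriosRoy2022LocalData, Thm. 3.4 and Thm. 3.5 (arXiv:2104.10337 p. 14–15)] [cite: SilvermanATAEC1994, IV.9.4 Steps 4 and 9] -/
theorem valued_Ψ₂Sq_adicCompletion_even_iff_kodairaSymbolAt_eq_III
    (hv : ((primesEquiv (R := ℤ) v : Nat.Primes) : ℕ) = 3)
    (hK : W.kodairaSymbolAt v = .III ∨ W.kodairaSymbolAt v = .IIIstar)
    {x₀ : v.adicCompletion ℚ} (hx₀ : (W.baseChange (v.adicCompletion ℚ)).Ψ₃.eval x₀ = 0) :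
    (∃ m : ℤ, Valued.v ((W.baseChange (v.adicCompletion ℚ)).Ψ₂Sq.eval x₀) = exp (2 * m)) ↔
      W.kodairaSymbolAt v = .III :=
  W.valuation_Ψ₂Sq_baseChange_even_iff_kodairaSymbolAt_eq_III v Valued.v hv hK
    (fun a => valuedAdicCompletion_eq_valuation' v a) hx₀

/-- **Type III at `3`, in `ℚᵥ`**: even exponent. [cite: BarriosRoy2022LocalData, Thm. 3.4 and Thm. 3.5] -/
theorem valued_Ψ₂Sq_adicCompletion_eq_exp_even_of_kodairaSymbolAt_eq_III
    (hv : ((primesEquiv (R := ℤ) v : Nat.Primes) : ℕ) = 3) (hK : W.kodairaSymbolAt v = .III)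
    {x₀ : v.adicCompletion ℚ} (hx₀ : (W.baseChange (v.adicCompletion ℚ)).Ψ₃.eval x₀ = 0) :
    ∃ m : ℤ, Valued.v ((W.baseChange (v.adicCompletion ℚ)).Ψ₂Sq.eval x₀) = exp (2 * m) :=
  W.valuation_Ψ₂Sq_baseChange_eq_exp_even_of_kodairaSymbolAt_eq_III v Valued.v hv hK
    (fun a => valuedAdicCompletion_eq_valuation' v a) hx₀

/-- **Type III* at `3`, in `ℚᵥ`**: odd exponent. [cite: BarriosRoy2022LocalData, Thm. 3.5] -/
theorem valued_Ψ₂Sq_adicCompletion_eq_exp_odd_of_kodairaSymbolAt_eq_IIIstar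
    (hv : ((primesEquiv (R := ℤ) v : Nat.Primes) : ℕ) = 3) (hK : W.kodairaSymbolAt v = .IIIstar)
    {x₀ : v.adicCompletion ℚ} (hx₀ : (W.baseChange (v.adicCompletion ℚ)).Ψ₃.eval x₀ = 0) :
    ∃ m : ℤ, Valued.v ((W.baseChange (v.adicCompletion ℚ)).Ψ₂Sq.eval x₀) = exp (2 * m + 1) :=
  W.valuation_Ψ₂Sq_baseChange_eq_exp_odd_of_kodairaSymbolAt_eq_IIIstar v Valued.v hv hK
    (fun a => valuedAdicCompletion_eq_valuation' v a) hx₀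

end LocalRows

end WeierstrassCurve
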